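import Mathlib
import Literature.MathematicalPhysics.QuantumFieldTheory.Dimock2011to13.CovarianceSquareRoot
import Literature.MathematicalPhysics.QuantumFieldTheory.Dimock2011to13.MultiRegionFreeFlow

/-!
# Dimock, *The renormalization group according to Balaban* II (large fields), §3.8 "fluctuation integral": the
# REGIONAL VERSUS GLOBAL DETERMINANT — `det C^{1/2} = (det M)^{−1/2}`, (stay1), and the LOG-DETERMINANT AS A
# RESOLVENT INTEGRAL behind (z5) `log[Δ_k + (a/L²)QᵀQ] = log a_k[I − QᵀQ] + log(a_k + aL^{−2})[QᵀQ] − a_k²∫₀^∞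
# [A_{k,r}Q_kG_{k,r}Q_kᵀA_{k,r}]dr` (*"See (3.22) in [Bal96b] for the derivation"*), TRACED, with *"provided the
# integral converges"* DISCHARGED, the footnote's count `tr[QᵀQ] = |Ω^{(k+1)}|` and the constant `b_k` — PROVED as
# finite-dimensional spectral calculus

**Citation header (reproduction of PUBLISHED work; template of the Bałaban lattice Yang–Mills cell).**
J. Dimock, *The renormalization group according to Balaban II. Large fields*, J. Math. Phys. **54** (2013) 092301
(= arXiv:1212.5562v2) [Dimock2013BalabanII], §3.8 `\subsection{fluctuation integral} \label{bingo}`, TeX L3221–3273: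
(stay1) L3221–3227, (z5) L3228–3236, (stay2) L3237–3246, the footnote and the count L3247–3254, `b_k` L3255–3258,
(stay3)/`R^{(6)}`/`b′_k`/`b″_k` L3259–3273.  TeX line numbers refer to the arXiv source held by the cell on this hub at
`run/shared/lean/archive/nearmiss/qft-balaban/dimock/src/1212.5562/1212.5562.tex` (7217 lines, sha256[:16]
75c5792fc48eacbc); every quotation below was read there this session.  Dimock's papers are published and refereed and
are the cell's TEMPLATE, not manuscripts under audit; no quantity of the Bałaban series is touched.  The by-reference
target of this file: Dimock cites the operator-logarithm formula (z5) to Bałaban's [Bal96b] = T. Bałaban,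
*Localization expansions I. Functions of the "background" configurations*, Commun. Math. Phys. **182** (1996) 33–82,
eq. (3.22); the traced identity is proved here from first principles (spectral theorem + one-variable calculus), so
nothing of [Bal96b] is asserted or needed.  The resolvent identity it is combined with is App. C of part I,
[Dimock2013] (lion)/(two) — the tree's `FluctuationCovarianceIdentity.Ckr_eq` (imported through `CovarianceSquareRoot`,
which supplies the positivity `ckInv_posDef` of `C_k⁻¹ = Δ_k + aL⁻²QᵀQ`).

**What the paper prints (verbatim).**  L3221–3227: *"We also want to replace det(C^{1/2}_{k,Ω′}) by the global
determinant det(C^{1/2}_k).  We have  det(C^{1/2}_{k,Ω′}) = det(C^{1/2}_k) exp(−½ tr log([Δ_{k,Ω(Λ*_k)} +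
(a/L²)QᵀQ]_{Ω_{k+1}}) + ½ tr log(Δ_k + (a/L²)QᵀQ))"* (stay1).  L3228–3236: *"A variation of our formula for
C^{1/2}_{k,Ω′} is  log([Δ_{k,Ω(Λ*_k)} + (a/L²)QᵀQ]_{Ω_{k+1}}) = log a_k [I − QᵀQ]_{Ω_{k+1}} + log(a_k + aL^{−2})
[QᵀQ]_{Ω_{k+1}} − a_k² ∫₀^∞ [A_{k,r} Q_k G_{k,Ω′,r} Q_kᵀ A_{k,r}]_{Ω_{k+1}} dr  provided the integral converges.  See
(3.22) in [Bal96b] for the derivation.  A similar formula holds for log(Δ_k + (a/L²)QᵀQ)."* (z5).  L3247–3254: *"But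
for Ω ⊂ 𝕋^{−k}_{𝖬+𝖭−k}, tr[QᵀQ]_Ω means … tr[QᵀQ]_{Ω^{(k)}} = tr[QQᵀ]_{Ω^{(k+1)}} = tr[I]_{Ω^{(k+1)}} = |Ω^{(k+1)}| =
L^{−3}|Ω^{(k)}| and similarly tr[I − QᵀQ]_Ω = (1 − L^{−3})|Ω^{(k)}|."*  L3255–3258: *"So the first two terms in
(stay2) are ½((1 − L^{−3}) log a_k + L^{−3} log(a_k + aL^{−2}))|Ω^{c,(k)}_{k+1}| ≡ ½ b_k|Ω^{c,(k)}_{k+1}|"*.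

**What is reproduced here (kernel-checked, zero `sorry`).**  Finite-dimensional matrix calculus over `ℝ` on abstract
finite index types; `M` is any real symmetric positive-definite matrix (print: `[Δ_{k,Ω(Λ*_k)} + (a/L²)QᵀQ]_{Ω_{k+1}}`
on `Ω^{(k)}_{k+1}`, or the global `Δ_k + (a/L²)QᵀQ` on `𝕋⁰`), `C = M⁻¹`, `C^{1/2} = CFC.sqrt C` (Mathlib's positive
square root, as in the sibling `CovarianceSquareRoot`), `tr log M := log det M`.
* §1–§2 THE MECHANISM OF (z5): the scalar resolvent integral `∫₀^∞((r+1)⁻¹ − (r+λ)⁻¹)dr = log λ` and, by the spectral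
  theorem (private helpers: eigenvector unitary, `(M + r)⁻¹ = U diag((λ_k + r)⁻¹)U*`, `tr`, `det` of `U diag(g) U*`),
  **`log_det_eq_integral`**: `∫₀^∞ (#n·(r + 1)⁻¹ − tr(M + r)⁻¹) dr = log det M` with the integrand INTEGRABLE on `(0,∞)` —
  the trace of the operator identity `log M = ∫₀^∞((1 + r)⁻¹ − (M + r)⁻¹)dr`;
  **`log_det_sqrt_inv`**: `log det C^{1/2} = −½ log det M`; **`det_sqrt_inv_eq_mul_exp`** = (stay1) for ANY two
  positive-definite `M₁`, `M₀` (regional, global): `det C₁^{1/2} = det C₀^{1/2} · exp(−½ log det M₁ + ½ log det M₀)`.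
* §3 (z5) TRACED over the objects of `FluctuationCovarianceIdentity` (`proj Q = QᵀQ`, `Akr` = A_{k,r}, `Deltak` = Δ_k,
  `Gkr` = G_{k,r}, `Ckr` = C_{k,r}): **`trace_proj_eq_card`** (`QQᵀ = I ⟹ tr(QᵀQ) = #σ`, the footnote's count),
  `trace_one_sub_proj_eq` (`tr(I − QᵀQ) = #ι − #σ`), `trace_Akr`, **`integral_weights`** (`∫₀^∞(#ι(r+1)⁻¹ − tr A_{k,r})dr =
  log a_k·(#ι − #σ) + log(a_k + aL⁻²)·#σ`, integrably — the first two terms of (z5) under the trace);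
  **`integrableOn_trace_of_resolvent_eq`** + **`log_det_eq_of_resolvent_eq`**: for ANY positive-definite `M` whose
  resolvent has the shape (z2), `(M + r)⁻¹ = A_{k,r} + a_k² R(r)` (`r ≥ 0`), the trace `tr R(r)` is integrable on
  `(0,∞)` (*"provided the integral converges"* — DISCHARGED) and `log det M = log a_k·(#ι − #σ) + log(a_k + aL⁻²)·#σ −
  a_k² ∫₀^∞ tr R(r) dr`; instantiated with part I's App. C (`Ckr_eq`): **`integrableOn_trace_AQGQA`** and
  **`log_det_ckInv_eq`** — the *"similar formula"* for the global `log det(Δ_k + aL⁻²QᵀQ)` with `R(r) =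
  A_{k,r}Q_kG_{k,r}Q_kᵀA_{k,r}`, hypotheses only `D = −Δ + μ̄_k` symmetric positive definite, `QQᵀ = I`, `a_k > 0`,
  `aL⁻² ≥ 0`; **`weights_eq_bk_mul`**: with `#ι = N·#σ` (print `N = L³`) the weights term is `b_k·#ι`,
  `b_k = (1 − N⁻¹)log a_k + N⁻¹log(a_k + aL⁻²)`; a non-vacuity `example` (one-site model).
* §4 (v1.1) (z5) FOR THE REGIONAL OPERATOR ITSELF: the regional resolvent identity (z2)–(z3) is App. C Lemma (z4) of
  part II, kernel as `MultiRegionFreeFlow.CkOr_eq` (the `Ω_{k+1}`-block `[Δ_{k,Ω}]_{Ω_{k+1}}` of the multi-region Schur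
  complement `DeltakO` is `Deltak (D + E) Q_k a_k`, `E = [Q_{k,Ω}ᵀ𝐚Q_{k,Ω}]_{Ω^c_{k+1}}` = `restE`, and `G_{k,Ω⁺,r}` =
  `GkOr` = `Gkr (D + E)`), so §3 applies verbatim: **`integrableOn_trace_AQGOrQA`** and **`log_det_ckOrInv_eq` (hD :
  D.PosDef) (haτ : 𝐚_τ.PosSemidef) (hQ : QQᵀ = I) (hak : 0 < a_k) (haL : 0 ≤ aL) : log det([Δ_{k,Ω}]_{Ω_{k+1}} + aL·QᵀQ)
  = log a_k·(#ι − #σ) + log(a_k + aL)·#σ − a_k²∫₀^∞ tr(A_{k,r}Q_kG_{k,Ω⁺,r}Q_kᵀA_{k,r})dr** — the printed (z5) under the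
  trace, with the integral convergent, hypotheses only `D = [−Δ + μ̄_k]_{Ω₁}` positive definite, layer weights `𝐚_τ ≥ 0`,
  `QQᵀ = I`, `a_k > 0`, `aL ≥ 0`; and **`det_sqrt_regional_eq`**: (stay1) with BOTH log-determinants expanded by (z5)
  (the exponent of (stay2) up to the count `tr[·]_{𝕋} − tr[·]_{Ω} = tr[·]_{Ω^c}` — with the integral pair carrying the
  signs `(+ regional, − global)` forced by (stay1)+(z5), where the printed (stay2) has `(−, +)`: see the SIGN NOTE at
  `det_sqrt_regional_eq`, v1.1.1).

**Readings (declared).**  (i) `tr log M` of a positive-definite real symmetric `M` is read as `log det M` (= `Σ log λ_k`,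
the trace of the spectral logarithm); the operator-valued (z5) is reproduced UNDER THE TRACE, which is the only way
§3.8 uses it ((stay1)–(stay3)).  (ii) §3 takes any resolvent identity of the SHAPE (z2) as the hypothesis `hres`; it is instantiated with
part I's (lion) (`FluctuationCovarianceIdentity.Ckr_eq`; the global operator, Dimock's *"similar formula"*, L3236) and
— §4, v1.1 — with part II's App. C (z4) (`MultiRegionFreeFlow.CkOr_eq`; the regional operator of (z5) itself).  ⟦v1
of this header said the regional identity was "NOT in the tree"; that was WRONG — it has been kernel since
`MultiRegionFreeFlow` (cell records v8.45), and v1.1 uses it.⟧  (iii) Abstract finite index types `ι` (unit lattice), `κ` (fine lattice), `σ` (next lattice) and abstract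
`Q_k`, `Q` with `QQᵀ = I` as in the sibling leaves; `aL` stands for `a/L²`.  (iv) Improper integrals are Lebesgue
integrals over `Ioi 0`, with integrability proved (constant-sign derivative of `log(r+1) − log(r+λ)`).

**What is NOT claimed.**  (z2)–(z3) are not restated (they are `MultiRegionFreeFlow.CkOr_eq`); the regrouping (stay2) → (stay3) (traces over `Ω_{k+1}` vs `Ω^c_{k+1}`
of one global operator — bookkeeping over a partition of sites, not typed here), `R^{(6)}`, `b′_k` (*"independent of
x"*, translation invariance) and its boundedness in `k`, `b″_k`, `c_{k+1}`, (sugar); Lemma 3.8 `r6`; the random-walk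
inputs; anything of B1–B16 (TEMPLATE.md §4.2 row «D2 §3.8 … det identities "(2.41) in [Bal98a]", "(3.22) in
[Bal96b]"» — the first identity is the sibling `LocalSquareRootDeterminant`, this file is the second; the Bałaban-side
log-det/resolvent calculus of [Balaban1985UV3] (63) is b10's `B10LogDet63` (`diff61_Ioi`), NOT imported and not
restated — its scalar lemma `integral_Ioi_inv_sub_inv` is re-proved privately here to keep the import cone inside
`Dimock2011to13/`).  NOT summit progress; NOT a statement about any Bałaban paper; NOT continuum; NOT Clay.  Imports:
Mathlib + the siblings `Dimock2011to13.CovarianceSquareRoot` (→ `FluctuationCovarianceIdentity`, `BlockAveragingMatrix`)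
and (v1.1) `Dimock2011to13.MultiRegionFreeFlow`; no Summits import; sub-namespace `…Dimock2011to13.RegionalLogDeterminant`;
modifies nothing.  Unit `b2b-balaban-template` gen 34 (journal CLAIM D2-Z5-LOGDET-KERNEL; v1.1 CLAIM D2-Z5-REGIONAL);
cell records TEMPLATE.md §4.2 row «D2 §3.8», GAPS C-tmpl34-2 (v1), C-tmpl34-5 (v1.1), C-tmpl35-7 (v1.1.1: docstring-only
fold of the cross-read at journal l.9404 — `det_sqrt_regional_eq` re-labelled with verbatim (stay1)+(z5) and a sign note;
no statement or proof changed).  v1.1 is additive: one import,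
§4, this header; every v1 declaration unchanged.
-/

noncomputable section

open scoped BigOperators Matrix MatrixOrder
open Finset MeasureTheory Set Filter Topology Matrix

namespace Literature.MathematicalPhysics.QuantumFieldTheory.Dimock2011to13.RegionalLogDeterminant

/-! ## §1 The scalar resolvent integral `∫₀^∞ ((1+r)⁻¹ − (λ+r)⁻¹) dr = log λ` -/

section Scalar

/-- `∫₀^∞ ((r + a)⁻¹ − (r + b)⁻¹) dr = log b − log a` for `a, b > 0`, the integrand being integrable on `(0, ∞)`.
[folklore] -/
private theorem integral_Ioi_inv_sub_inv {a b : ℝ} (ha : 0 < a) (hb : 0 < b) :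
    IntegrableOn (fun x : ℝ => (x + a)⁻¹ - (x + b)⁻¹) (Ioi 0) ∧
    ∫ x in Ioi (0 : ℝ), ((x + a)⁻¹ - (x + b)⁻¹) = Real.log b - Real.log a := by
  set F : ℝ → ℝ := fun x => Real.log (x + a) - Real.log (x + b) with hF
  have hderiv : ∀ x ∈ Ici (0 : ℝ), HasDerivAt F ((x + a)⁻¹ - (x + b)⁻¹) x := by
    intro x hx
    have hxa : x + a ≠ 0 := by have := mem_Ici.1 hx; positivity
    have hxb : x + b ≠ 0 := by have := mem_Ici.1 hx; positivity
    have h1 : HasDerivAt (fun x => Real.log (x + a)) ((x + a)⁻¹) x := by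
      simpa using ((hasDerivAt_id x).add_const a).log hxa
    have h2 : HasDerivAt (fun x => Real.log (x + b)) ((x + b)⁻¹) x := by
      simpa using ((hasDerivAt_id x).add_const b).log hxb
    exact h1.sub h2
  have hlim : Tendsto F atTop (𝓝 0) := by
    have h1 : Tendsto (fun x : ℝ => (x + a) / (x + b)) atTop (𝓝 1) := by
      have e : (fun x : ℝ => (x + a) / (x + b)) =ᶠ[atTop] fun x => 1 + (a - b) * (x + b)⁻¹ := by
        filter_upwards [eventually_gt_atTop 0] with x hx
        have hxb : x + b ≠ 0 := by positivity
        field_simp; ring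
      rw [tendsto_congr' e]
      have h2 : Tendsto (fun x : ℝ => (x + b)⁻¹) atTop (𝓝 0) :=
        tendsto_inv_atTop_zero.comp (tendsto_atTop_add_const_right atTop b tendsto_id)
      simpa using (h2.const_mul (a - b)).const_add 1
    have h3 : Tendsto (fun x : ℝ => Real.log ((x + a) / (x + b))) atTop (𝓝 0) := by
      have := (Real.continuousAt_log one_ne_zero).tendsto.comp h1
      rw [Real.log_one] at this
      exact this
    refine h3.congr' ?_
    filter_upwards [eventually_gt_atTop 0] with x hx
    have hxa : 0 < x + a := by positivity
    have hxb : 0 < x + b := by positivity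
    rw [hF]; dsimp only; rw [Real.log_div hxa.ne' hxb.ne']
  have hF0 : F 0 = Real.log a - Real.log b := by simp [hF]
  have hint : IntegrableOn (fun x : ℝ => (x + a)⁻¹ - (x + b)⁻¹) (Ioi 0) := by
    rcases le_total a b with hab | hab
    · refine integrableOn_Ioi_deriv_of_nonneg' hderiv (fun x hx => ?_) hlim
      have hx0 : 0 < x := hx
      have hxa : 0 < x + a := by positivity
      rw [sub_nonneg]; exact inv_anti₀ hxa (by linarith)
    · have hderiv' : ∀ x ∈ Ici (0 : ℝ), HasDerivAt (fun x => -F x) (-((x + a)⁻¹ - (x + b)⁻¹)) x :=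
        fun x hx => (hderiv x hx).neg
      have hlim' : Tendsto (fun x => -F x) atTop (𝓝 (-0)) := hlim.neg
      have h := integrableOn_Ioi_deriv_of_nonneg' hderiv' (fun x hx => ?_) hlim'
      · convert h.neg using 1; funext x; simp only [Pi.neg_apply]; ring
      have hx0 : 0 < x := hx
      have hxb : 0 < x + b := by positivity
      rw [neg_sub, sub_nonneg]; exact inv_anti₀ hxb (by linarith)
  refine ⟨hint, ?_⟩
  rw [integral_Ioi_of_hasDerivAt_of_tendsto' hderiv hint hlim, hF0]; ring

/-- The scalar case of the logarithm as a resolvent integral: `∫₀^∞ ((r + 1)⁻¹ − (r + λ)⁻¹) dr = log λ` (`λ > 0`),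
integrably. [folklore] -/
private theorem integral_Ioi_inv_add_one_sub_inv_add {l : ℝ} (hl : 0 < l) :
    IntegrableOn (fun r : ℝ => (r + 1)⁻¹ - (r + l)⁻¹) (Ioi 0) ∧
    ∫ r in Ioi (0 : ℝ), ((r + 1)⁻¹ - (r + l)⁻¹) = Real.log l := by
  have h := integral_Ioi_inv_sub_inv one_pos hl
  rw [Real.log_one, sub_zero] at h
  exact h

end Scalar

/-! ## §2 Matrix level: `log det M = ∫₀^∞ (#n·(r+1)⁻¹ − tr (M + r)⁻¹) dr` for a positive-definite real symmetric `M` -/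

section Spectral

variable {n : Type*} [Fintype n] [DecidableEq n] {M : Matrix n n ℝ}

/-- the orthogonal matrix of eigenvectors. [folklore] -/
private noncomputable def eigU (hM : M.PosDef) : Matrix n n ℝ := (hM.1.eigenvectorUnitary : Matrix n n ℝ)

/-- the eigenvalues. [folklore] -/
private noncomputable def eig (hM : M.PosDef) : n → ℝ := hM.1.eigenvalues

/-- spectral multiplier `E(g) = U diag(g) U*`. [folklore] -/
private noncomputable def specMul (hM : M.PosDef) (g : n → ℝ) : Matrix n n ℝ :=
  eigU hM * diagonal g * star (eigU hM)

/-- `U*U = 1`. [folklore] -/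
private theorem star_eigU_mul (hM : M.PosDef) : star (eigU hM) * eigU hM = 1 :=
  Unitary.coe_star_mul_self hM.1.eigenvectorUnitary

/-- `UU* = 1`. [folklore] -/
private theorem eigU_mul_star (hM : M.PosDef) : eigU hM * star (eigU hM) = 1 :=
  Unitary.coe_mul_star_self hM.1.eigenvectorUnitary

/-- the eigenvalues are positive. [folklore] -/
private theorem eig_pos (hM : M.PosDef) (k : n) : 0 < eig hM k := hM.eigenvalues_pos k

/-- `E(1) = 1`. [folklore] -/
private theorem specMul_one (hM : M.PosDef) : specMul hM 1 = 1 := by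
  unfold specMul
  rw [show diagonal (1 : n → ℝ) = 1 from diagonal_one, Matrix.mul_one, eigU_mul_star]

/-- `E(g)E(h) = E(gh)`. [folklore] -/
private theorem specMul_mul (hM : M.PosDef) (g h : n → ℝ) : specMul hM g * specMul hM h = specMul hM (g * h) := by
  unfold specMul
  calc eigU hM * diagonal g * star (eigU hM) * (eigU hM * diagonal h * star (eigU hM))
      = eigU hM * diagonal g * (star (eigU hM) * eigU hM) * diagonal h * star (eigU hM) := by
        simp only [Matrix.mul_assoc]
    _ = eigU hM * diagonal (g * h) * star (eigU hM) := by
        rw [star_eigU_mul, Matrix.mul_one, Matrix.mul_assoc (eigU hM) (diagonal g), diagonal_mul_diagonal]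
        rfl

/-- `E` is additive. [folklore] -/
private theorem specMul_add (hM : M.PosDef) (g h : n → ℝ) : specMul hM (g + h) = specMul hM g + specMul hM h := by
  unfold specMul
  have hd : diagonal (g + h) = diagonal g + diagonal h := by rw [diagonal_add]; rfl
  rw [hd, Matrix.mul_add, Matrix.add_mul]

/-- `E` is homogeneous. [folklore] -/
private theorem specMul_smul (hM : M.PosDef) (c : ℝ) (g : n → ℝ) : specMul hM (c • g) = c • specMul hM g := by
  unfold specMul
  rw [diagonal_smul, Matrix.mul_smul, Matrix.smul_mul]

/-- `E(c) = c·1`. [folklore] -/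
private theorem specMul_const (hM : M.PosDef) (c : ℝ) : specMul hM (fun _ => c) = c • (1 : Matrix n n ℝ) := by
  have : (fun _ : n => c) = c • (1 : n → ℝ) := by ext k; simp
  rw [this, specMul_smul, specMul_one]

/-- the spectral theorem `M = U diag(λ) U*`. [folklore] -/
private theorem eq_specMul_eig (hM : M.PosDef) : M = specMul hM (eig hM) := by
  have h := hM.1.spectral_theorem
  rw [Unitary.conjStarAlgAut_apply] at h
  simpa [specMul, eigU, eig] using h

/-- the trace of `E(g)` is `Σ_k g_k` (cyclicity). [folklore] -/
private theorem trace_specMul (hM : M.PosDef) (g : n → ℝ) : trace (specMul hM g) = ∑ k, g k := by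
  unfold specMul
  rw [Matrix.mul_assoc, Matrix.trace_mul_comm, Matrix.mul_assoc, star_eigU_mul, Matrix.mul_one, trace_diagonal]

/-- the resolvent `(M + r)⁻¹ = U diag((λ_k + r)⁻¹) U*` for `r ≥ 0`. [folklore] -/
private theorem inv_add_smul_one_eq (hM : M.PosDef) {r : ℝ} (hr : 0 ≤ r) :
    (M + r • (1 : Matrix n n ℝ))⁻¹ = specMul hM (fun k => (eig hM k + r)⁻¹) := by
  have hsum : M + r • (1 : Matrix n n ℝ) = specMul hM (fun k => eig hM k + r) := by
    have : (fun k => eig hM k + r) = eig hM + fun _ => r := by ext k; simp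
    rw [this, specMul_add, specMul_const, ← eq_specMul_eig hM]
  apply Matrix.inv_eq_right_inv
  rw [hsum, specMul_mul]
  have : ((fun k => eig hM k + r) * fun k => (eig hM k + r)⁻¹) = 1 := by
    ext k
    simp only [Pi.mul_apply, Pi.one_apply]
    exact mul_inv_cancel₀ (by have := eig_pos hM k; linarith)
  rw [this, specMul_one]

/-- **`tr (M + r)⁻¹ = Σ_k (λ_k + r)⁻¹`** (`r ≥ 0`) for a positive-definite real symmetric `M`. [folklore] -/
private theorem trace_resolvent_eq_sum (hM : M.PosDef) {r : ℝ} (hr : 0 ≤ r) :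
    trace ((M + r • (1 : Matrix n n ℝ))⁻¹) = ∑ k, (eig hM k + r)⁻¹ := by
  rw [inv_add_smul_one_eq hM hr, trace_specMul]

/-- `log det M = Σ_k log λ_k`. [folklore] -/
private theorem log_det_eq_sum (hM : M.PosDef) : Real.log M.det = ∑ k, Real.log (eig hM k) := by
  rw [hM.1.det_eq_prod_eigenvalues]
  simp only [RCLike.ofReal_real_eq_id, id_eq]
  exact Real.log_prod (fun k _ => (hM.eigenvalues_pos k).ne')

/-- **The logarithm of the determinant as a resolvent integral** — the traced form of the operator identity
`log M = ∫₀^∞ ((1 + r)⁻¹ − (M + r)⁻¹) dr` behind (z5) (*"See (3.22) in [Bal96b] for the derivation"*): for every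
positive-definite real symmetric `M` on a finite index set `n`,
`∫₀^∞ (#n·(r + 1)⁻¹ − tr (M + r)⁻¹) dr = log det M`, the integrand being integrable on `(0,∞)`.
[cite: Dimock2013BalabanII, §3.8 eq. (z5) (arXiv:1212.5562v2 TeX L3228–3236)] -/
theorem log_det_eq_integral (hM : M.PosDef) :
    IntegrableOn (fun r : ℝ => (Fintype.card n : ℝ) * (r + 1)⁻¹ - trace ((M + r • (1 : Matrix n n ℝ))⁻¹)) (Ioi 0) ∧
    ∫ r in Ioi (0 : ℝ), ((Fintype.card n : ℝ) * (r + 1)⁻¹ - trace ((M + r • (1 : Matrix n n ℝ))⁻¹))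
      = Real.log M.det := by
  have heq : EqOn (fun r : ℝ => (Fintype.card n : ℝ) * (r + 1)⁻¹ - trace ((M + r • (1 : Matrix n n ℝ))⁻¹))
      (fun r => ∑ k, ((r + 1)⁻¹ - (r + eig hM k)⁻¹)) (Ioi 0) := by
    intro r hr
    have hr' : 0 ≤ r := le_of_lt hr
    simp only [trace_resolvent_eq_sum hM hr', Finset.sum_sub_distrib, Finset.sum_const, Finset.card_univ,
      nsmul_eq_mul]
    congr 1
    exact Finset.sum_congr rfl fun k _ => by rw [add_comm]
  have hint : IntegrableOn (fun r : ℝ => ∑ k, ((r + 1)⁻¹ - (r + eig hM k)⁻¹)) (Ioi 0) :=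
    integrable_finsetSum _ fun k _ => (integral_Ioi_inv_add_one_sub_inv_add (eig_pos hM k)).1
  refine ⟨hint.congr_fun heq.symm measurableSet_Ioi, ?_⟩
  rw [setIntegral_congr_fun measurableSet_Ioi heq,
    integral_finsetSum _ (fun k _ => (integral_Ioi_inv_add_one_sub_inv_add (eig_pos hM k)).1),
    log_det_eq_sum hM]
  exact Finset.sum_congr rfl fun k _ => (integral_Ioi_inv_add_one_sub_inv_add (eig_pos hM k)).2

/-- `E(g) ≥ 0` for `g ≥ 0`. [folklore] -/
private theorem specMul_posSemidef (hM : M.PosDef) {g : n → ℝ} (hg : ∀ k, 0 ≤ g k) : (specMul hM g).PosSemidef := by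
  unfold specMul
  have hD : (diagonal g).PosSemidef := PosSemidef.diagonal fun k => hg k
  have h := hD.mul_mul_conjTranspose_same (eigU hM)
  rwa [← Matrix.star_eq_conjTranspose] at h

/-- `(M⁻¹)^{1/2} = U diag(λ_k^{−1/2}) U*` (Mathlib's `CFC.sqrt`, by uniqueness of the positive square root).
[folklore] -/
private theorem sqrt_inv_eq_specMul (hM : M.PosDef) : CFC.sqrt M⁻¹ = specMul hM (fun k => (√(eig hM k))⁻¹) := by
  have hinv : M⁻¹ = specMul hM (fun k => (eig hM k)⁻¹) := by
    have h := inv_add_smul_one_eq hM le_rfl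
    simpa using h
  apply CFC.sqrt_unique
  · rw [specMul_mul, hinv]
    congr 1
    ext k
    simp only [Pi.mul_apply]
    rw [← mul_inv, Real.mul_self_sqrt (eig_pos hM k).le]
  · exact (specMul_posSemidef hM fun k => inv_nonneg.2 (Real.sqrt_nonneg _)).nonneg

/-- `det E(g) = Π_k g_k`. [folklore] -/
private theorem det_specMul (hM : M.PosDef) (g : n → ℝ) : (specMul hM g).det = ∏ k, g k := by
  unfold specMul
  rw [det_mul, det_mul, det_diagonal, mul_comm (eigU hM).det, mul_assoc, ← det_mul, eigU_mul_star, det_one,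
    mul_one]

/-- **`log det C^{1/2} = −½ log det M`** for `C = M⁻¹`, `M` positive definite, `C^{1/2}` Mathlib's positive square root
`CFC.sqrt C` — the conversion between Dimock's `det(C^{1/2}_{k,Ω′})` of (stay1) and the `tr log` of `[Δ_k + aL⁻²QᵀQ]`.
[cite: Dimock2013BalabanII, §3.8 eq. (stay1) (arXiv:1212.5562v2 TeX L3221–3227)] -/
theorem log_det_sqrt_inv (hM : M.PosDef) : Real.log (CFC.sqrt M⁻¹).det = -(1 / 2) * Real.log M.det := by
  rw [sqrt_inv_eq_specMul hM, det_specMul, log_det_eq_sum hM,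
    Real.log_prod (fun k _ => (inv_pos.2 (Real.sqrt_pos.2 (eig_pos hM k))).ne'), Finset.mul_sum]
  refine Finset.sum_congr rfl fun k _ => ?_
  rw [Real.log_inv, Real.log_sqrt (eig_pos hM k).le]
  ring

/-- `det C^{1/2} > 0`. [folklore] -/
private theorem det_sqrt_inv_pos (hM : M.PosDef) : 0 < (CFC.sqrt M⁻¹).det := by
  rw [sqrt_inv_eq_specMul hM, det_specMul]
  exact Finset.prod_pos fun k _ => inv_pos.2 (Real.sqrt_pos.2 (eig_pos hM k))

/-- **(stay1)**: *"det(C^{1/2}_{k,Ω′}) = det(C^{1/2}_k) exp(−½ tr log([Δ_{k,Ω(Λ*_k)} + (a/L²)QᵀQ]_{Ω_{k+1}}) + ½ tr log(Δ_k +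
(a/L²)QᵀQ))"* — for ANY two positive-definite matrices `M₁` (print: the regional `[Δ_{k,Ω} + aL⁻²QᵀQ]_{Ω_{k+1}}`, on its
own index set) and `M₀` (the global `Δ_k + aL⁻²QᵀQ`), with `C_i = M_i⁻¹` and `tr log M_i = log det M_i`:
`det C₁^{1/2} = det C₀^{1/2} · exp(−½ log det M₁ + ½ log det M₀)`.
[cite: Dimock2013BalabanII, §3.8 eq. (stay1) (arXiv:1212.5562v2 TeX L3221–3227)] -/
theorem det_sqrt_inv_eq_mul_exp {n₀ : Type*} [Fintype n₀] [DecidableEq n₀] {M₀ : Matrix n₀ n₀ ℝ} (hM₁ : M.PosDef)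
    (hM₀ : M₀.PosDef) :
    (CFC.sqrt M⁻¹).det
      = (CFC.sqrt M₀⁻¹).det * Real.exp (-(1 / 2) * Real.log M.det + (1 / 2) * Real.log M₀.det) := by
  have h1 := det_sqrt_inv_pos hM₁
  have h0 := det_sqrt_inv_pos hM₀
  rw [← Real.exp_log h1, ← Real.exp_log h0, ← Real.exp_add, log_det_sqrt_inv hM₁, log_det_sqrt_inv hM₀]
  ring_nf

end Spectral

/-! ## §3 Dimock's (z5), traced: the weights `A_{k,r}` integrate to `log a_k·tr(I − QᵀQ) + log(a_k + aL⁻²)·tr(QᵀQ)`,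
and `log det(Δ_k + aL⁻²QᵀQ) = … − a_k² ∫₀^∞ tr(A_{k,r}Q_kG_{k,r}Q_kᵀA_{k,r}) dr` -/

section Z5

open FluctuationCovarianceIdentity

variable {ι κ σ : Type*} [Fintype ι] [Fintype κ] [Fintype σ] [DecidableEq ι] [DecidableEq κ] [DecidableEq σ]
variable {D : Matrix κ κ ℝ} {Qk : Matrix ι κ ℝ} {Q : Matrix σ ι ℝ} {ak aL : ℝ}

omit [Fintype κ] [DecidableEq ι] [DecidableEq κ] in
/-- **The footnote's trace count**: *"tr[QᵀQ]_{Ω^{(k)}} = tr[QQᵀ]_{Ω^{(k+1)}} = tr[I]_{Ω^{(k+1)}} = |Ω^{(k+1)}|"* — for `QQᵀ = I`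
(block averaging), `tr(QᵀQ) = #σ` (the number of coarse sites; `= L^{−3}|Ω^{(k)}|` in the print).
[cite: Dimock2013BalabanII, §3.8 footnote and display after (stay2) (arXiv:1212.5562v2 TeX L3244–3253)] -/
theorem trace_proj_eq_card (hQ : Q * Qᵀ = 1) : trace (proj Q) = Fintype.card σ := by
  unfold proj
  rw [Matrix.trace_mul_comm, hQ, Matrix.trace_one]

omit [Fintype κ] [DecidableEq κ] in
/-- *"and similarly tr[I − QᵀQ]_Ω = (1 − L^{−3})|Ω^{(k)}|"*: `tr(I − QᵀQ) = #ι − #σ`.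
[cite: Dimock2013BalabanII, §3.8 display after (stay2) (arXiv:1212.5562v2 TeX L3252–3253)] -/
theorem trace_one_sub_proj_eq (hQ : Q * Qᵀ = 1) :
    trace ((1 : Matrix ι ι ℝ) - proj Q) = Fintype.card ι - Fintype.card σ := by
  rw [Matrix.trace_sub, Matrix.trace_one, trace_proj_eq_card hQ]

omit [Fintype κ] [DecidableEq κ] in
/-- The trace of the weights: `tr A_{k,r} = (#ι − #σ)(a_k + r)⁻¹ + #σ(a_k + aL⁻² + r)⁻¹`. [cite: Dimock2013BalabanII,
§3.8 (z3)/(z5) (arXiv:1212.5562v2 TeX L3144–3149, L3228–3236)] -/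
theorem trace_Akr (hQ : Q * Qᵀ = 1) (r : ℝ) :
    trace (Akr Q ak aL r) = (Fintype.card ι - Fintype.card σ) * (ak + r)⁻¹ + Fintype.card σ * (ak + aL + r)⁻¹ := by
  unfold Akr
  rw [Matrix.trace_add, Matrix.trace_smul, Matrix.trace_smul, trace_one_sub_proj_eq hQ, trace_proj_eq_card hQ,
    smul_eq_mul, smul_eq_mul]
  ring

omit [Fintype κ] [DecidableEq κ] in
/-- **The first two terms of (z5), traced**: `∫₀^∞ (#ι(r+1)⁻¹ − tr A_{k,r}) dr = log a_k·(#ι − #σ) + log(a_k + aL⁻²)·#σ`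
(= *"log a_k [I − QᵀQ] + log(a_k + aL^{−2})[QᵀQ]"* under the trace; integrably), for `a_k > 0`, `aL⁻² ≥ 0`, `QQᵀ = I`.
[cite: Dimock2013BalabanII, §3.8 eq. (z5) and the display before (stay3) (arXiv:1212.5562v2 TeX L3228–3257)] -/
theorem integral_weights (hQ : Q * Qᵀ = 1) (hak : 0 < ak) (haL : 0 ≤ aL) :
    IntegrableOn (fun r : ℝ => (Fintype.card ι : ℝ) * (r + 1)⁻¹ - trace (Akr Q ak aL r)) (Ioi 0) ∧
    ∫ r in Ioi (0 : ℝ), ((Fintype.card ι : ℝ) * (r + 1)⁻¹ - trace (Akr Q ak aL r))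
      = Real.log ak * (Fintype.card ι - Fintype.card σ) + Real.log (ak + aL) * Fintype.card σ := by
  have h1 := integral_Ioi_inv_add_one_sub_inv_add hak
  have h2 := integral_Ioi_inv_add_one_sub_inv_add (show 0 < ak + aL by linarith)
  have heq : (fun r : ℝ => (Fintype.card ι : ℝ) * (r + 1)⁻¹ - trace (Akr Q ak aL r))
      = fun r => (Fintype.card ι - Fintype.card σ : ℝ) * ((r + 1)⁻¹ - (r + ak)⁻¹)
          + (Fintype.card σ : ℝ) * ((r + 1)⁻¹ - (r + (ak + aL))⁻¹) := by
    funext r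
    rw [trace_Akr hQ r, add_comm ak r, show ak + aL + r = r + (ak + aL) by ring]
    ring
  rw [heq]
  refine ⟨(h1.1.const_mul _).add (h2.1.const_mul _), ?_⟩
  rw [integral_add (h1.1.const_mul _) (h2.1.const_mul _), integral_const_mul, integral_const_mul, h1.2, h2.2]
  ring

omit [Fintype κ] [DecidableEq κ] in
/-- **(z5) from a resolvent identity of shape (z2), the integral CONVERGES**: if a positive-definite `M` on the
unit-lattice index set has resolvent `(M + r)⁻¹ = A_{k,r} + a_k² R(r)` for all `r ≥ 0` (print: (z2) with
`R(r) = [A_{k,r}Q_kG_{k,Ω′,r}Q_kᵀA_{k,r}]_{Ω_{k+1}}`, App. C), then `r ↦ tr R(r)` is integrable on `(0,∞)` — *"provided the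
integral converges"*, DISCHARGED: `tr R(r) = a_k⁻²(tr(M + r)⁻¹ − tr A_{k,r})`, a difference of integrable resolvent traces.
[cite: Dimock2013BalabanII, §3.8 eqs. (z2), (z5) (arXiv:1212.5562v2 TeX L3139–3149, L3228–3236)] -/
theorem integrableOn_trace_of_resolvent_eq {M : Matrix ι ι ℝ} (hM : M.PosDef) (hQ : Q * Qᵀ = 1) (hak : 0 < ak)
    (haL : 0 ≤ aL) (R : ℝ → Matrix ι ι ℝ)
    (hres : ∀ r : ℝ, 0 ≤ r → (M + r • (1 : Matrix ι ι ℝ))⁻¹ = Akr Q ak aL r + ak ^ 2 • R r) :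
    IntegrableOn (fun r : ℝ => trace (R r)) (Ioi 0) := by
  have hA := (integral_weights (Q := Q) (ak := ak) (aL := aL) (ι := ι) hQ hak haL).1
  have hC := (log_det_eq_integral hM).1
  have h' : IntegrableOn (fun r : ℝ => (ak ^ 2)⁻¹ * (((Fintype.card ι : ℝ) * (r + 1)⁻¹ - trace (Akr Q ak aL r))
      - ((Fintype.card ι : ℝ) * (r + 1)⁻¹ - trace ((M + r • (1 : Matrix ι ι ℝ))⁻¹)))) (Ioi 0) :=
    (hA.sub hC).const_mul _
  have heq : EqOn (fun r : ℝ => trace (R r))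
      (fun r => (ak ^ 2)⁻¹ * (((Fintype.card ι : ℝ) * (r + 1)⁻¹ - trace (Akr Q ak aL r))
        - ((Fintype.card ι : ℝ) * (r + 1)⁻¹ - trace ((M + r • (1 : Matrix ι ι ℝ))⁻¹)))) (Ioi 0) := by
    intro r hr
    have hr' : 0 ≤ r := le_of_lt hr
    simp only
    rw [hres r hr', Matrix.trace_add, Matrix.trace_smul, smul_eq_mul]
    have hak2 : ak ^ 2 ≠ 0 := pow_ne_zero 2 hak.ne'
    field_simp
    ring
  exact h'.congr_fun heq.symm measurableSet_Ioi

omit [Fintype κ] [DecidableEq κ] in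
/-- **(z5), traced, from a resolvent identity of shape (z2)**: under the same hypotheses,
`log det M = log a_k·(#ι − #σ) + log(a_k + aL⁻²)·#σ − a_k² ∫₀^∞ tr R(r) dr` — the trace of *"log([Δ_{k,Ω(Λ*_k)} +
(a/L²)QᵀQ]_{Ω_{k+1}}) = log a_k [I − QᵀQ]_{Ω_{k+1}} + log(a_k + aL^{−2})[QᵀQ]_{Ω_{k+1}} − a_k²∫₀^∞ [A_{k,r}Q_kG_{k,Ω′,r}Q_kᵀ
A_{k,r}]_{Ω_{k+1}} dr provided the integral converges. See (3.22) in [Bal96b] for the derivation"* — for ANY positive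
definite `M` whose resolvent has the shape (z2) (the regional identity (z2) itself, App. C of part II, is the INPUT `hres`).
[cite: Dimock2013BalabanII, §3.8 eq. (z5) (arXiv:1212.5562v2 TeX L3228–3236)] -/
theorem log_det_eq_of_resolvent_eq {M : Matrix ι ι ℝ} (hM : M.PosDef) (hQ : Q * Qᵀ = 1) (hak : 0 < ak)
    (haL : 0 ≤ aL) (R : ℝ → Matrix ι ι ℝ)
    (hres : ∀ r : ℝ, 0 ≤ r → (M + r • (1 : Matrix ι ι ℝ))⁻¹ = Akr Q ak aL r + ak ^ 2 • R r) :
    Real.log M.det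
      = Real.log ak * (Fintype.card ι - Fintype.card σ) + Real.log (ak + aL) * Fintype.card σ
        - ak ^ 2 * ∫ r in Ioi (0 : ℝ), trace (R r) := by
  have hA := integral_weights (Q := Q) (ak := ak) (aL := aL) (ι := ι) hQ hak haL
  have hC := log_det_eq_integral hM
  have hT := integrableOn_trace_of_resolvent_eq hM hQ hak haL R hres
  have heq : EqOn (fun r : ℝ => (Fintype.card ι : ℝ) * (r + 1)⁻¹ - trace ((M + r • (1 : Matrix ι ι ℝ))⁻¹))
      (fun r => ((Fintype.card ι : ℝ) * (r + 1)⁻¹ - trace (Akr Q ak aL r)) - ak ^ 2 * trace (R r)) (Ioi 0) := by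
    intro r hr
    have hr' : 0 ≤ r := le_of_lt hr
    simp only
    rw [hres r hr', Matrix.trace_add, Matrix.trace_smul, smul_eq_mul]
    ring
  rw [← hC.2, setIntegral_congr_fun measurableSet_Ioi heq, integral_sub hA.1 (hT.const_mul _), hA.2,
    integral_const_mul]

/-- **The "similar formula" for the global operator** (L3236: *"A similar formula holds for log(Δ_k + (a/L²)QᵀQ)"*),
the integral CONVERGING: for `D = −Δ + μ̄_k` symmetric positive definite, `QQᵀ = I`, `a_k > 0`, `aL⁻² ≥ 0`,
`r ↦ tr(A_{k,r}Q_kG_{k,r}Q_kᵀA_{k,r})` is integrable on `(0,∞)`; the resolvent identity is App. C of part I, (two) =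
(lion), the tree's `FluctuationCovarianceIdentity.Ckr_eq`. [cite: Dimock2013BalabanII, §3.8 eq. (z5) and L3236 (arXiv:1212.5562v2 TeX L3228–3236)] -/
theorem integrableOn_trace_AQGQA (hD : D.PosDef) (hQ : Q * Qᵀ = 1) (hak : 0 < ak) (haL : 0 ≤ aL) :
    IntegrableOn (fun r : ℝ => trace (Akr Q ak aL r * Qk * Gkr D Qk Q ak aL r * Qkᵀ * Akr Q ak aL r)) (Ioi 0) := by
  have hM : (Deltak D Qk ak + aL • proj Q).PosDef := CovarianceSquareRoot.ckInv_posDef hD hak haL Q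
  refine integrableOn_trace_of_resolvent_eq hM hQ hak haL _ fun r hr => ?_
  rw [show (Deltak D Qk ak + aL • proj Q + r • (1 : Matrix ι ι ℝ))⁻¹ = Ckr D Qk Q ak aL r from rfl]
  exact Ckr_eq (Qk := Qk) hD hQ hak haL hr

/-- **(z5), traced, for the global operator** (*"A similar formula holds for log(Δ_k + (a/L²)QᵀQ)"*): for `D = −Δ + μ̄_k`
symmetric positive definite, `QQᵀ = I`, `a_k > 0`, `aL⁻² ≥ 0`,
`log det(Δ_k + aL⁻²QᵀQ) = log a_k·(#ι − #σ) + log(a_k + aL⁻²)·#σ − a_k² ∫₀^∞ tr(A_{k,r}Q_kG_{k,r}Q_kᵀA_{k,r}) dr`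
with `Δ_k`, `A_{k,r}`, `G_{k,r}` the objects of `FluctuationCovarianceIdentity` (`−½` of this is `log det C_k^{1/2}`,
`C_k = (Δ_k + aL⁻²QᵀQ)⁻¹`, by `log_det_sqrt_inv`). [cite: Dimock2013BalabanII, §3.8 eq. (z5) and L3236 (arXiv:1212.5562v2 TeX L3228–3236)] -/
theorem log_det_ckInv_eq (hD : D.PosDef) (hQ : Q * Qᵀ = 1) (hak : 0 < ak) (haL : 0 ≤ aL) :
    Real.log (Deltak D Qk ak + aL • proj Q).det
      = Real.log ak * (Fintype.card ι - Fintype.card σ) + Real.log (ak + aL) * Fintype.card σ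
        - ak ^ 2 * ∫ r in Ioi (0 : ℝ), trace (Akr Q ak aL r * Qk * Gkr D Qk Q ak aL r * Qkᵀ * Akr Q ak aL r) := by
  have hM : (Deltak D Qk ak + aL • proj Q).PosDef := CovarianceSquareRoot.ckInv_posDef hD hak haL Q
  refine log_det_eq_of_resolvent_eq hM hQ hak haL
    (fun r => Akr Q ak aL r * Qk * Gkr D Qk Q ak aL r * Qkᵀ * Akr Q ak aL r) fun r hr => ?_
  rw [show (Deltak D Qk ak + aL • proj Q + r • (1 : Matrix ι ι ℝ))⁻¹ = Ckr D Qk Q ak aL r from rfl]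
  exact Ckr_eq (Qk := Qk) hD hQ hak haL hr

omit [Fintype κ] [DecidableEq ι] [DecidableEq κ] [DecidableEq σ] in
/-- **The per-site constant `b_k`**: when every coarse site carries `N` fine sites (`#ι = N·#σ`; print `N = L³`),
`log a_k·(#ι − #σ) + log(a_k + aL⁻²)·#σ = b_k·#ι` with `b_k = (1 − N⁻¹) log a_k + N⁻¹ log(a_k + aL⁻²)` — *"So the first
two terms in (stay2) are ½((1 − L^{−3}) log a_k + L^{−3} log(a_k + aL^{−2}))|Ω^{c,(k)}_{k+1}| ≡ ½ b_k|Ω^{c,(k)}_{k+1}|"*.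
[cite: Dimock2013BalabanII, §3.8 display before (stay3) (arXiv:1212.5562v2 TeX L3254–3257)] -/
theorem weights_eq_bk_mul {N : ℕ} (hN : Fintype.card ι = N * Fintype.card σ) (hN0 : N ≠ 0) :
    Real.log ak * (Fintype.card ι - Fintype.card σ) + Real.log (ak + aL) * Fintype.card σ
      = ((1 - (N : ℝ)⁻¹) * Real.log ak + (N : ℝ)⁻¹ * Real.log (ak + aL)) * Fintype.card ι := by
  have hN' : (N : ℝ) ≠ 0 := Nat.cast_ne_zero.2 hN0
  have hι : (Fintype.card ι : ℝ) = N * Fintype.card σ := by exact_mod_cast hN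
  rw [hι]
  field_simp

/-- Non-vacuity: the hypotheses of (z5)-traced are met by the one-site model `D = Q_k = Q = 1`, `a_k = 1`, `aL⁻² = 0`. -/
example : Real.log (Deltak (1 : Matrix (Fin 1) (Fin 1) ℝ) (1 : Matrix (Fin 1) (Fin 1) ℝ) 1
      + (0 : ℝ) • proj (1 : Matrix (Fin 1) (Fin 1) ℝ)).det
    = Real.log 1 * (Fintype.card (Fin 1) - Fintype.card (Fin 1)) + Real.log (1 + 0) * Fintype.card (Fin 1)
      - 1 ^ 2 * ∫ r in Ioi (0 : ℝ), trace (Akr (1 : Matrix (Fin 1) (Fin 1) ℝ) 1 0 r * (1 : Matrix (Fin 1) (Fin 1) ℝ)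
        * Gkr (1 : Matrix (Fin 1) (Fin 1) ℝ) (1 : Matrix (Fin 1) (Fin 1) ℝ) (1 : Matrix (Fin 1) (Fin 1) ℝ) 1 0 r
        * (1 : Matrix (Fin 1) (Fin 1) ℝ)ᵀ * Akr (1 : Matrix (Fin 1) (Fin 1) ℝ) 1 0 r) :=
  log_det_ckInv_eq (Qk := (1 : Matrix (Fin 1) (Fin 1) ℝ)) Matrix.PosDef.one (by simp) one_pos le_rfl

end Z5

/-! ## §4 (v1.1) (z5) for the regional operator `[Δ_{k,Ω(Λ*_k)} + (a/L²)QᵀQ]_{Ω_{k+1}}` via App. C (z4) -/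

section Z5Regional

open FluctuationCovarianceIdentity MultiRegionFreeFlow

variable {ι κ σ τ : Type*} [Fintype ι] [Fintype κ] [Fintype σ] [Fintype τ] [DecidableEq ι] [DecidableEq κ]
  [DecidableEq σ]
variable {D : Matrix κ κ ℝ} {Qk : Matrix ι κ ℝ} {Qτ : Matrix τ κ ℝ} {aτ : Matrix τ τ ℝ} {Q : Matrix σ ι ℝ} {ak aL : ℝ}

omit [DecidableEq κ] in
/-- `E = Q_τᵀ𝐚_τQ_τ ≥ 0` for `𝐚_τ ≥ 0`. [folklore] -/
private theorem restE_posSemidef (haτ : aτ.PosSemidef) (Qτ : Matrix τ κ ℝ) : (restE aτ Qτ).PosSemidef := by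
  have h := haτ.conjTranspose_mul_mul_same Qτ
  rwa [conjTranspose_eq_transpose_of_trivial] at h

/-- The regional trace `tr(A_{k,r}Q_kG_{k,Ω⁺,r}Q_kᵀA_{k,r})` is integrable on `(0,∞)` (*"provided the integral
converges"* — it does). [cite: Dimock2013BalabanII, §3.8 eq. (z5) (arXiv:1212.5562v2 TeX L3228–3236); App. C (z4) L6586–6601] -/
theorem integrableOn_trace_AQGOrQA (hD : D.PosDef) (haτ : aτ.PosSemidef) (hQ : Q * Qᵀ = 1) (hak : 0 < ak)
    (haL : 0 ≤ aL) :
    IntegrableOn (fun r : ℝ =>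
      trace (Akr Q ak aL r * Qk * GkOr D ak aτ Qk Qτ Q aL r * Qkᵀ * Akr Q ak aL r)) (Ioi 0) := by
  have h := integrableOn_trace_AQGQA (Qk := Qk) (hD.add_posSemidef (restE_posSemidef haτ Qτ)) hQ hak haL
  refine h.congr_fun (fun r hr => ?_) measurableSet_Ioi
  have hr' : 0 < r := hr
  rw [GkOr_eq_Gkr (by linarith) (by linarith)]

/-- **(z5) FOR THE REGIONAL OPERATOR, TRACED** — *"log([Δ_{k,Ω(Λ*_k)} + (a/L²)QᵀQ]_{Ω_{k+1}}) = log a_k[I − QᵀQ]_{Ω_{k+1}}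
+ log(a_k + aL^{−2})[QᵀQ]_{Ω_{k+1}} − a_k²∫₀^∞[A_{k,r}Q_kG_{k,Ω′,r}Q_kᵀA_{k,r}]_{Ω_{k+1}}dr provided the integral
converges. See (3.22) in [Bal96b] for the derivation"*: with `[Δ_{k,Ω}]_{Ω_{k+1}}` the `Ω_{k+1}`-block of the multi-region
Schur complement (`MultiRegionFreeFlow.DeltakO` at the split weight `a_k ⊕ 𝐚_τ` and rows `(Q_k, Q_τ)`) and `G_{k,Ω⁺,r}` =
`MultiRegionFreeFlow.GkOr`: `log det([Δ_{k,Ω}]_{Ω_{k+1}} + aL·QᵀQ) = log a_k·(#ι − #σ) + log(a_k + aL)·#σ −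
a_k²∫₀^∞ tr(A_{k,r}Q_kG_{k,Ω⁺,r}Q_kᵀA_{k,r})dr`, the integral convergent — hypotheses only `D = [−Δ + μ̄_k]_{Ω₁}`
positive definite, `𝐚_τ ≥ 0`, `QQᵀ = I`, `a_k > 0`, `aL ≥ 0`. Proof: App. C (z4) (`CkOr_eq`) is a resolvent identity
of the shape (z2), and §3 applies. [cite: Dimock2013BalabanII, §3.8 eq. (z5) (arXiv:1212.5562v2 TeX L3228–3236); App. C Lemma (z4) L6586–6601] -/
theorem log_det_ckOrInv_eq (hD : D.PosDef) (haτ : aτ.PosSemidef) (hQ : Q * Qᵀ = 1) (hak : 0 < ak) (haL : 0 ≤ aL) :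
    Real.log ((DeltakO D (weightO ak aτ) (rowsO Qk Qτ)).toBlocks₁₁ + aL • proj Q).det
      = Real.log ak * (Fintype.card ι - Fintype.card σ) + Real.log (ak + aL) * Fintype.card σ
        - ak ^ 2 * ∫ r in Ioi (0 : ℝ),
            trace (Akr Q ak aL r * Qk * GkOr D ak aτ Qk Qτ Q aL r * Qkᵀ * Akr Q ak aL r) := by
  rw [DeltakO_toBlocks₁₁, log_det_ckInv_eq (hD.add_posSemidef (restE_posSemidef haτ Qτ)) hQ hak haL]
  congr 2
  refine setIntegral_congr_fun measurableSet_Ioi fun r hr => ?_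
  have hr' : 0 < r := hr
  rw [GkOr_eq_Gkr (by linarith) (by linarith)]

/-- **(stay1) with both `tr log`'s expanded by (z5)** — (stay1), verbatim L3221–3227: *"det(C^{1/2}_{k,Ω′}) = det(C^{1/2}_k)
exp(−½ tr log([Δ_{k,Ω(Λ*_k)} + (a/L²)QᵀQ]_{Ω_{k+1}}) + ½ tr log(Δ_k + (a/L²)QᵀQ))"*; (z5), verbatim L3228–3236: *"log([Δ_{k,
Ω(Λ*_k)} + (a/L²)QᵀQ]_{Ω_{k+1}}) = log a_k [I − QᵀQ]_{Ω_{k+1}} + log(a_k + aL^{−2})[QᵀQ]_{Ω_{k+1}} − a_k²∫₀^∞[A_{k,r}Q_kG_{k,Ω′,r}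
Q_kᵀA_{k,r}]_{Ω_{k+1}}dr … A similar formula holds for log(Δ_k + (a/L²)QᵀQ)"*.  Here, for the regional operator on
`Ω^{(k)}_{k+1}` (index type `ι`, fine sites `κ`, layers `τ`) and the global one on `𝕋⁰` (index type `ι₀`, fine sites
`κ₀`): `det C^{1/2}_{k,Ω′} = det C^{1/2}_k · exp(−½[(z5) regional] + ½[(z5) global])`, i.e. the exponent is `−½W_reg +
½W_glob + ½a_k²∫tr[A Q_kG_{k,Ω′,r}Q_kᵀA]dr − ½a_k²∫tr[A Q_kG_{k,r}Q_kᵀA]dr` with `W = log a_k·tr[I − QᵀQ] + log(a_k +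
aL^{−2})·tr[QᵀQ]`.  ⟦SIGN NOTE (v1.1.1; cross-reads at journal l.9287 INFO-1 and l.9404 RECORD-1, confirmed from the TeX):
the print's next display (stay2), L3237–3246, *"Thus the exponent in (stay1) can be written ½ log a_k tr[I −
QᵀQ]_{Ω^c_{k+1}} + ½ log(a_k + aL^{−2}) tr[QᵀQ]_{Ω^c_{k+1}} − ½a_k²∫₀^∞tr[A_{k,r}Q_kG_{k,Ω′,r}Q_kᵀA_{k,r}]_{Ω_{k+1}}dr +
½a_k²∫₀^∞tr[A_{k,r}Q_kG_{k,r}Q_kᵀA_{k,r}]dr"*, has the trace terms of this theorem (after the count `tr[·]_{𝕋} − tr[·]_{Ω}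
= tr[·]_{Ω^c}`, `trace_one_sub_proj_eq`) but the integral pair with the OPPOSITE signs `(−, +)`; (stay3), the sign of
`R^{(6)}` and `b″_k = b_k + a_k²b′_k` follow (stay2); only `|R^{(6)}(□)|` and the boundedness of `b′_k` are used
downstream, so nothing of substance depends on it — recorded as a sign-misprint candidate of the published template,
not adjudicated; this theorem carries the signs forced by `log_det_eq_integral` and (lion).⟧
[cite: Dimock2013BalabanII, §3.8 eqs. (stay1), (z5) (arXiv:1212.5562v2 TeX L3221–3236); (stay2) L3237–3246] -/
theorem det_sqrt_regional_eq {ι₀ κ₀ σ₀ : Type*} [Fintype ι₀] [Fintype κ₀] [Fintype σ₀] [DecidableEq ι₀]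
    [DecidableEq κ₀] [DecidableEq σ₀] {D₀ : Matrix κ₀ κ₀ ℝ} {Qk₀ : Matrix ι₀ κ₀ ℝ} {Q₀ : Matrix σ₀ ι₀ ℝ}
    (hD : D.PosDef) (haτ : aτ.PosSemidef) (hQ : Q * Qᵀ = 1) (hD₀ : D₀.PosDef) (hQ₀ : Q₀ * Q₀ᵀ = 1)
    (hak : 0 < ak) (haL : 0 ≤ aL) :
    (CFC.sqrt ((DeltakO D (weightO ak aτ) (rowsO Qk Qτ)).toBlocks₁₁ + aL • proj Q)⁻¹).det
      = (CFC.sqrt (Deltak D₀ Qk₀ ak + aL • proj Q₀)⁻¹).det *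
        Real.exp (-(1 / 2) * (Real.log ak * (Fintype.card ι - Fintype.card σ) + Real.log (ak + aL) * Fintype.card σ
            - ak ^ 2 * ∫ r in Ioi (0 : ℝ),
                trace (Akr Q ak aL r * Qk * GkOr D ak aτ Qk Qτ Q aL r * Qkᵀ * Akr Q ak aL r))
          + (1 / 2) * (Real.log ak * (Fintype.card ι₀ - Fintype.card σ₀) + Real.log (ak + aL) * Fintype.card σ₀
            - ak ^ 2 * ∫ r in Ioi (0 : ℝ),
                trace (Akr Q₀ ak aL r * Qk₀ * Gkr D₀ Qk₀ Q₀ ak aL r * Qk₀ᵀ * Akr Q₀ ak aL r))) := by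
  have hM : ((DeltakO D (weightO ak aτ) (rowsO Qk Qτ)).toBlocks₁₁ + aL • proj Q).PosDef := by
    rw [DeltakO_toBlocks₁₁]
    exact CovarianceSquareRoot.ckInv_posDef (hD.add_posSemidef (restE_posSemidef haτ Qτ)) hak haL Q
  have hM₀ : (Deltak D₀ Qk₀ ak + aL • proj Q₀).PosDef := CovarianceSquareRoot.ckInv_posDef hD₀ hak haL Q₀
  rw [det_sqrt_inv_eq_mul_exp hM hM₀, log_det_ckOrInv_eq hD haτ hQ hak haL, log_det_ckInv_eq hD₀ hQ₀ hak haL]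

end Z5Regional

end Literature.MathematicalPhysics.QuantumFieldTheory.Dimock2011to13.RegionalLogDeterminant

end
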